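import Summits.SmoothPoincare4.SmoothPoincare4.Theorems.NoGenusTwoDoor.Negative.OpenSubsetConstForm
import Literature.AlgebraicTopology.SingularHomology.CircleProductHomology

/-!
# `NoGenusTwoDoor` minus compactness is false (negative lemma for crux stmt-SmoothPoincare4-7842)

`SymplecticOrigami.NoGenusTwoDoor` ("no closed connected symplectic 4-manifold has
`(b₁, b₂) = (2, 1)`") with the binder `[CompactSpace N]` deleted is refuted by the cotangent bundle
of the torus, realised as the open subset `U = (ℝ² ∖ 0) × (ℝ² ∖ 0) ⊂ ℝ⁴` with the constant form
`s = dx₀ ∧ dx₁ + dx₂ ∧ dx₃`: `U` is `ℝ⁴`-charted `C^∞`, Hausdorff, second countable, path connected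
(`pathConnectedSpace_U`) and not compact (`not_compactSpace_U`); `s` is smooth and closed
(part 1, `OpenSubsetConstForm`) and non-degenerate (`omega0_nondegenerate`: `ω₀(v, Jv) = |v|²`);
`U ≃ₕ S¹ × S¹ ≃ₜ T²` by radial projection (`homotopyEquivTorus`), so `rank H₁(U; ℤ) = 2`,
`rank H₂(U; ℤ) = 1` by the tree's `Hₖ(T²; ℤ) ≅ ℤ^(2 choose k)` and homotopy invariance
(`finrank_singularHomologyZ_U`). Hence `exists_noncompact_door` and
`noGenusTwoDoor_false_without_compact`: any proof of the crux must use compactness; and the crux's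
form hypotheses (smooth ∧ closed ∧ non-degenerate `MForm`) are certified NON-VACUOUS on an
`(𝓡 4)`-manifold of the tree. Refuter negative lemma (cdisprove seat), supports the crux item;
see `Cruxes/NoGenusTwoDoor/Disproof.lean` §5.
-/

noncomputable section

-- the prescribed namespace `Summit.<P>.<Sub>.…` duplicates `SmoothPoincare4` (P = Sub)
set_option linter.dupNamespace false

open scoped Manifold ContDiff Topology
open Set Filter Literature.Geometry.Kaehler Literature.AlgebraicTopology.SingularHomology

namespace Summit.SmoothPoincare4.SmoothPoincare4.Theorems.NoGenusTwoDoor.Negative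

/-- The model space `ℝ⁴`. [folklore] -/
abbrev E4 : Type := EuclideanSpace ℝ (Fin 4)

/-- The standard symplectic pairing on `ℝ⁴`. [folklore] -/
def B (v w : E4) : ℝ := v 0 * w 1 - v 1 * w 0 + v 2 * w 3 - v 3 * w 2

/-- `ω₀ = dx₀ ∧ dx₁ + dx₂ ∧ dx₃` as a continuous alternating 2-form on `ℝ⁴`. [folklore] -/
def omega0 : E4 [⋀^Fin 2]→L[ℝ] ℝ where
  toFun v := B (v 0) (v 1)
  map_update_add' := by
    intro _ m i x y
    fin_cases i <;> (simp [B]; ring)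
  map_update_smul' := by
    intro _ m i c x
    fin_cases i <;> (simp [B]; ring)
  cont := by
    show Continuous fun v : Fin 2 → E4 ↦ B (v 0) (v 1)
    unfold B
    fun_prop
  map_eq_zero_of_eq' := by
    intro v i j hij hne
    fin_cases i <;> fin_cases j
    · exact absurd rfl hne
    · have h : v 0 = v 1 := hij
      show B (v 0) (v 1) = 0; rw [h]; simp [B]; ring
    · have h : v 1 = v 0 := hij
      show B (v 0) (v 1) = 0; rw [← h]; simp [B]; ring
    · exact absurd rfl hne

/-- `ω₀` on a pair of vectors. [folklore] -/
theorem omega0_apply (v w : E4) : omega0 ![v, w] = B v w := rfl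

/-- The symplectic partner `Jv = (−v₁, v₀, −v₃, v₂)`. [folklore] -/
def Jv (v : E4) : E4 := (WithLp.equiv 2 _).symm ![-(v 1), v 0, -(v 3), v 2]

/-- `ω₀(v, Jv) = |v|²`. [folklore] -/
theorem B_Jv (v : E4) : B v (Jv v) = v 0 ^ 2 + v 1 ^ 2 + v 2 ^ 2 + v 3 ^ 2 := by
  simp [B, Jv]; ring

/-- `ω₀` is non-degenerate. [folklore] -/
theorem omega0_nondegenerate (v : E4) (hv : v ≠ 0) : ∃ w, omega0 ![v, w] ≠ 0 := by
  refine ⟨Jv v, ?_⟩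
  rw [omega0_apply, B_Jv]
  intro h
  apply hv
  have hs := fun i : Fin 4 ↦ sq_nonneg (v i)
  have h0 : v 0 = 0 := by nlinarith [hs 0, hs 1, hs 2, hs 3]
  have h1 : v 1 = 0 := by nlinarith [hs 0, hs 1, hs 2, hs 3]
  have h2 : v 2 = 0 := by nlinarith [hs 0, hs 1, hs 2, hs 3]
  have h3 : v 3 = 0 := by nlinarith [hs 0, hs 1, hs 2, hs 3]
  ext i; fin_cases i <;> simp [h0, h1, h2, h3]

/-- The carrier `{x | (x₀, x₁) ≠ 0 ∧ (x₂, x₃) ≠ 0}`. [folklore] -/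
def Uset : Set E4 := ({x | x 0 ≠ 0} ∪ {x | x 1 ≠ 0}) ∩ ({x | x 2 ≠ 0} ∪ {x | x 3 ≠ 0})

/-- A coordinate being non-zero is an open condition. [folklore] -/
theorem isOpen_ne_coord (i : Fin 4) : IsOpen {x : E4 | x i ≠ 0} :=
  isOpen_ne_fun (f := fun x : E4 ↦ x i) (by fun_prop) continuous_const

/-- `Uset` is open. [folklore] -/
theorem isOpen_Uset : IsOpen Uset :=
  ((isOpen_ne_coord 0).union (isOpen_ne_coord 1)).inter ((isOpen_ne_coord 2).union (isOpen_ne_coord 3))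

/-- `U` as an open subset of `ℝ⁴`; as a type it is an `ℝ⁴`-charted `C^∞` manifold (Mathlib). [folklore] -/
def U : TopologicalSpace.Opens E4 := ⟨Uset, isOpen_Uset⟩

/-- Membership in `U`, unfolded. [folklore] -/
theorem mem_U_iff (x : E4) : x ∈ U ↔ (x 0 ≠ 0 ∨ x 1 ≠ 0) ∧ (x 2 ≠ 0 ∨ x 3 ≠ 0) := by
  show x ∈ Uset ↔ _
  simp [Uset]

/-- The witness form: constantly `ω₀` (tangent spaces of an `ℝ⁴`-charted manifold are `ℝ⁴`). [folklore] -/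
def sU : MForm (𝓡 4) U ℝ 2 := fun _ ↦ omega0

/-- `sU` is chartwise smooth (part 1: constant forms on open subsets are smooth). [folklore] -/
theorem isSmoothForm_sU : IsSmoothForm sU := isSmoothForm_const (V := U) omega0

/-- `sU` is closed (part 1: constant forms on open subsets are closed). [folklore] -/
theorem isClosedForm_sU : IsClosedForm sU := isClosedForm_const (V := U) omega0

/-- `sU` is pointwise non-degenerate. [folklore] -/
theorem sU_nondegenerate (x : U) (v : TangentSpace (𝓡 4) x) (hv : v ≠ 0) :
    ∃ w, sU x ![v, w] ≠ 0 :=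
  omega0_nondegenerate v hv

open Complex in
/-- The first coordinate pair as a complex number. [folklore] -/
def zA (x : E4) : ℂ := (x 0 : ℂ) + (x 1 : ℂ) * I

open Complex in
/-- The second coordinate pair as a complex number. [folklore] -/
def zB (x : E4) : ℂ := (x 2 : ℂ) + (x 3 : ℂ) * I

/-- Real and imaginary parts of `zA`, `zB`. [folklore] -/
@[simp] theorem zA_zB_re_im (x : E4) :
    (zA x).re = x 0 ∧ (zA x).im = x 1 ∧ (zB x).re = x 2 ∧ (zB x).im = x 3 := by
  simp [zA, zB]

/-- `zA` is continuous. [folklore] -/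
theorem continuous_zA : Continuous zA := by unfold zA; fun_prop
/-- `zB` is continuous. [folklore] -/
theorem continuous_zB : Continuous zB := by unfold zB; fun_prop

/-- On `U` the first pair is non-zero. [folklore] -/
theorem zA_ne_zero {x : E4} (hx : x ∈ U) : zA x ≠ 0 := by
  intro h
  have h0 := congrArg Complex.re h
  have h1 := congrArg Complex.im h
  simp only [zA_zB_re_im, Complex.zero_re, Complex.zero_im] at h0 h1
  rcases ((mem_U_iff x).1 hx).1 with h | h <;> contradiction

/-- On `U` the second pair is non-zero. [folklore] -/
theorem zB_ne_zero {x : E4} (hx : x ∈ U) : zB x ≠ 0 := by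
  intro h
  have h0 := congrArg Complex.re h
  have h1 := congrArg Complex.im h
  simp only [zA_zB_re_im, Complex.zero_re, Complex.zero_im] at h0 h1
  rcases ((mem_U_iff x).1 hx).2 with h | h <;> contradiction

/-- Radial projection of a non-zero complex number to the unit circle. [folklore] -/
def toCirc (z : ℂ) (hz : z ≠ 0) : Circle :=
  ⟨(‖z‖⁻¹ : ℝ) • z, mem_sphere_zero_iff_norm.2 (by
    rw [norm_smul, norm_inv, norm_norm, inv_mul_cancel₀ (norm_ne_zero_iff.2 hz)])⟩

/-- The underlying complex number of `toCirc`. [folklore] -/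
@[simp] theorem coe_toCirc (z : ℂ) (hz : z ≠ 0) : (toCirc z hz : ℂ) = (‖z‖⁻¹ : ℝ) • z := rfl

/-- `ρ : U → S¹ × S¹`, radial projection in each factor. [folklore] -/
def rho : C(U, Circle × Circle) where
  toFun x := (toCirc (zA x) (zA_ne_zero x.2), toCirc (zB x) (zB_ne_zero x.2))
  continuous_toFun := by
    have hA : Continuous fun x : U ↦ zA (x : E4) := continuous_zA.comp continuous_subtype_val
    have hB : Continuous fun x : U ↦ zB (x : E4) := continuous_zB.comp continuous_subtype_val
    refine Continuous.prodMk ?_ ?_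
    · exact Continuous.subtype_mk
        (((continuous_norm.comp hA).inv₀ fun x ↦ norm_ne_zero_iff.2 (zA_ne_zero x.2)).smul hA) _
    · exact Continuous.subtype_mk
        (((continuous_norm.comp hB).inv₀ fun x ↦ norm_ne_zero_iff.2 (zB_ne_zero x.2)).smul hB) _

/-- Points of `ℝ⁴` from four coordinates. [folklore] -/
def pt (a b c d : ℝ) : E4 :=
  a • EuclideanSpace.single 0 1 + b • EuclideanSpace.single 1 1 + c • EuclideanSpace.single 2 1 +
    d • EuclideanSpace.single 3 1

/-- Coordinates of `pt`. [folklore] -/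
@[simp] theorem pt_apply (a b c d : ℝ) :
    pt a b c d 0 = a ∧ pt a b c d 1 = b ∧ pt a b c d 2 = c ∧ pt a b c d 3 = d := by
  simp [pt]

/-- `pt` is continuous in its four arguments. [folklore] -/
theorem continuous_pt : Continuous fun p : ℝ × ℝ × ℝ × ℝ ↦ pt p.1 p.2.1 p.2.2.1 p.2.2.2 := by
  unfold pt; fun_prop

/-- `pt` of the coordinates of `x` is `x`. [folklore] -/
theorem pt_eq (x : E4) : pt (x 0) (x 1) (x 2) (x 3) = x := by
  ext i; fin_cases i <;> simp

/-- A non-zero complex number has a non-zero real or imaginary part. [folklore] -/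
theorem re_ne_or_im_ne {z : ℂ} (hz : z ≠ 0) : z.re ≠ 0 ∨ z.im ≠ 0 := by
  by_contra h
  simp only [not_or, not_not] at h
  exact hz (Complex.ext h.1 h.2)

/-- When both pairs are non-zero, `pt` lands in `U`. [folklore] -/
theorem pt_mem {a b c d : ℝ} (h1 : a ≠ 0 ∨ b ≠ 0) (h2 : c ≠ 0 ∨ d ≠ 0) : pt a b c d ∈ U := by
  rw [mem_U_iff]; simpa using ⟨h1, h2⟩

/-- The map `S¹ × S¹ → ℝ⁴`, `(u, w) ↦ (Re u, Im u, Re w, Im w)`. [folklore] -/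
def iotaFun (p : Circle × Circle) : E4 := pt (p.1 : ℂ).re (p.1 : ℂ).im (p.2 : ℂ).re (p.2 : ℂ).im

/-- `iotaFun` lands in `U`. [folklore] -/
theorem iotaFun_mem (p : Circle × Circle) : iotaFun p ∈ U :=
  pt_mem (re_ne_or_im_ne p.1.coe_ne_zero) (re_ne_or_im_ne p.2.coe_ne_zero)

/-- `iotaFun` is continuous. [folklore] -/
theorem continuous_iotaFun : Continuous iotaFun := by
  have h : iotaFun = (fun p : ℝ × ℝ × ℝ × ℝ ↦ pt p.1 p.2.1 p.2.2.1 p.2.2.2) ∘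
      fun p : Circle × Circle ↦ ((p.1 : ℂ).re, (p.1 : ℂ).im, (p.2 : ℂ).re, (p.2 : ℂ).im) := rfl
  rw [h]
  exact continuous_pt.comp (by fun_prop)

/-- `ι : S¹ × S¹ → U`. [folklore] -/
def iota : C(Circle × Circle, U) :=
  ⟨fun p ↦ ⟨iotaFun p, iotaFun_mem p⟩, continuous_iotaFun.subtype_mk iotaFun_mem⟩

/-- `ρ ∘ ι = 𝟙`. [folklore] -/
theorem rho_iota (p : Circle × Circle) : rho (iota p) = p := by
  obtain ⟨u, w⟩ := p
  have hu : zA (iotaFun (u, w)) = u := by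
    apply Complex.ext <;> simp [iotaFun]
  have hw : zB (iotaFun (u, w)) = w := by
    apply Complex.ext <;> simp [iotaFun]
  refine Prod.ext (Circle.ext ?_) (Circle.ext ?_)
  · show ((‖zA (iotaFun (u, w))‖⁻¹ : ℝ) • zA (iotaFun (u, w)) : ℂ) = u
    rw [hu, Circle.norm_coe, inv_one, one_smul]
  · show ((‖zB (iotaFun (u, w))‖⁻¹ : ℝ) • zB (iotaFun (u, w)) : ℂ) = w
    rw [hw, Circle.norm_coe, inv_one, one_smul]

/-- The radial coefficient `t + (1 − t)/r` of the straight-line homotopy. [folklore] -/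
def coef (t r : ℝ) : ℝ := t + (1 - t) * r⁻¹

/-- The radial coefficient is positive for `t ∈ [0, 1]`, `r > 0`. [folklore] -/
theorem coef_pos {t r : ℝ} (ht0 : 0 ≤ t) (ht1 : t ≤ 1) (hr : 0 < r) : 0 < coef t r := by
  unfold coef
  have hr' : 0 < r⁻¹ := inv_pos.2 hr
  rcases lt_or_eq_of_le ht1 with h | h
  · nlinarith
  · subst h; norm_num

/-- The straight-line homotopy from `ι ∘ ρ` to the identity, as a map to `ℝ⁴`. [folklore] -/
def homotopyFun (p : unitInterval × U) : E4 :=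
  pt (coef p.1 ‖zA p.2‖ * (p.2 : E4) 0) (coef p.1 ‖zA p.2‖ * (p.2 : E4) 1)
    (coef p.1 ‖zB p.2‖ * (p.2 : E4) 2) (coef p.1 ‖zB p.2‖ * (p.2 : E4) 3)

/-- The homotopy stays inside `U` (it rescales each pair by a positive factor). [folklore] -/
theorem homotopyFun_mem (p : unitInterval × U) : homotopyFun p ∈ U := by
  have hA : 0 < coef p.1 ‖zA p.2‖ :=
    coef_pos p.1.2.1 p.1.2.2 (norm_pos_iff.2 (zA_ne_zero p.2.2))
  have hB : 0 < coef p.1 ‖zB p.2‖ :=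
    coef_pos p.1.2.1 p.1.2.2 (norm_pos_iff.2 (zB_ne_zero p.2.2))
  obtain ⟨h1, h2⟩ := (mem_U_iff _).1 p.2.2
  apply pt_mem
  · rcases h1 with h | h
    · exact Or.inl (mul_ne_zero hA.ne' h)
    · exact Or.inr (mul_ne_zero hA.ne' h)
  · rcases h2 with h | h
    · exact Or.inl (mul_ne_zero hB.ne' h)
    · exact Or.inr (mul_ne_zero hB.ne' h)

/-- The homotopy is continuous. [folklore] -/
theorem continuous_homotopyFun : Continuous homotopyFun := by
  have hA : Continuous fun p : unitInterval × U ↦ zA (p.2 : E4) :=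
    continuous_zA.comp (continuous_subtype_val.comp continuous_snd)
  have hB : Continuous fun p : unitInterval × U ↦ zB (p.2 : E4) :=
    continuous_zB.comp (continuous_subtype_val.comp continuous_snd)
  have hcA : Continuous fun p : unitInterval × U ↦ coef p.1 ‖zA (p.2 : E4)‖ := by
    unfold coef
    exact (continuous_subtype_val.comp continuous_fst).add
      ((continuous_const.sub (continuous_subtype_val.comp continuous_fst)).mul
        ((continuous_norm.comp hA).inv₀ fun p ↦ norm_ne_zero_iff.2 (zA_ne_zero p.2.2)))
  have hcB : Continuous fun p : unitInterval × U ↦ coef p.1 ‖zB (p.2 : E4)‖ := by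
    unfold coef
    exact (continuous_subtype_val.comp continuous_fst).add
      ((continuous_const.sub (continuous_subtype_val.comp continuous_fst)).mul
        ((continuous_norm.comp hB).inv₀ fun p ↦ norm_ne_zero_iff.2 (zB_ne_zero p.2.2)))
  have h : homotopyFun = (fun p : ℝ × ℝ × ℝ × ℝ ↦ pt p.1 p.2.1 p.2.2.1 p.2.2.2) ∘
      fun p : unitInterval × U ↦ (coef p.1 ‖zA (p.2 : E4)‖ * (p.2 : E4) 0,
        coef p.1 ‖zA (p.2 : E4)‖ * (p.2 : E4) 1, coef p.1 ‖zB (p.2 : E4)‖ * (p.2 : E4) 2,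
        coef p.1 ‖zB (p.2 : E4)‖ * (p.2 : E4) 3) := rfl
  rw [h]
  exact continuous_pt.comp (by fun_prop)

/-- The straight-line homotopy `ι ∘ ρ ≃ 𝟙_U`. [folklore] -/
def iotaRhoHomotopy : ContinuousMap.Homotopy (iota.comp rho) (ContinuousMap.id U) where
  toFun p := ⟨homotopyFun p, homotopyFun_mem p⟩
  continuous_toFun := continuous_homotopyFun.subtype_mk homotopyFun_mem
  map_zero_left x := by
    apply Subtype.ext
    show homotopyFun (0, x) = iotaFun (rho x)
    simp [homotopyFun, coef, iotaFun, rho]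
  map_one_left x := by
    apply Subtype.ext
    show homotopyFun (1, x) = (x : E4)
    simp [homotopyFun, coef, pt_eq]

/-- `U ≃ₕ S¹ × S¹`. [folklore] -/
def homotopyEquivCC : ContinuousMap.HomotopyEquiv U (Circle × Circle) where
  toFun := rho
  invFun := iota
  left_inv := ⟨iotaRhoHomotopy⟩
  right_inv := by
    have : rho.comp iota = ContinuousMap.id _ := by
      ext1 p; exact rho_iota p
    rw [this]

/-- `U` is path connected (every point is joined to the path-connected set `ι(S¹ × S¹)`). [folklore] -/
theorem pathConnectedSpace_U : PathConnectedSpace U := by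
  haveI : PathConnectedSpace (Circle × Circle) := inferInstance
  have joined : ∀ x : U, Joined (iota (rho x)) x := fun x ↦
    ⟨{ toFun := fun t ↦ iotaRhoHomotopy (t, x)
       continuous_toFun := by fun_prop
       source' := iotaRhoHomotopy.map_zero_left x
       target' := iotaRhoHomotopy.map_one_left x }⟩
  refine ⟨⟨iota (Classical.arbitrary _)⟩, fun x y ↦ ?_⟩
  have jm : Joined (iota (rho x)) (iota (rho y)) :=
    ⟨(PathConnectedSpace.somePath (rho x) (rho y)).map iota.continuous⟩
  exact (joined x).symm.trans (jm.trans (joined y))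

/-- `U` is not compact (a non-empty proper open subset of the connected `ℝ⁴` is not closed). [folklore] -/
theorem not_compactSpace_U : ¬ CompactSpace U := by
  intro hc
  have hcl : IsClosed (U : Set E4) := by
    have : IsCompact (U : Set E4) := by
      rw [← Subtype.range_coe (s := (U : Set E4))]
      exact isCompact_range continuous_subtype_val
    exact this.isClosed
  have hclopen : IsClopen (U : Set E4) := ⟨hcl, U.isOpen⟩
  rcases isClopen_iff.1 hclopen with h | h
  · have hmem : pt 1 0 1 0 ∈ (U : Set E4) := pt_mem (Or.inl one_ne_zero) (Or.inl one_ne_zero)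
    rw [h] at hmem
    exact hmem
  · have hmem : (0 : E4) ∈ (U : Set E4) := by rw [h]; trivial
    have := (mem_U_iff 0).1 hmem
    simp at this

/-- `S¹ × S¹ ≃ₜ T²` (Mathlib's `Circle` versus the tree's `Torus 2 = Fin 2 → ℝ/ℤ`). [folklore] -/
def circleProdHomeomorphTorus : Circle × Circle ≃ₜ Torus 2 :=
  let h : UnitAddCircle ≃ₜ Circle := AddCircle.homeomorphCircle one_ne_zero
  ((h.symm.prodCongr h.symm).trans
    ((Homeomorph.funUnique (Fin 1) UnitAddCircle).symm.prodCongr (Homeomorph.refl _))).trans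
    (torusSplit 1).symm

/-- `U ≃ₕ T²`. [folklore] -/
def homotopyEquivTorus : ContinuousMap.HomotopyEquiv U (Torus 2) :=
  homotopyEquivCC.trans circleProdHomeomorphTorus.toHomotopyEquiv

/-- `rank Hₖ(U; ℤ) = (2 choose k)` (tree: `Hₖ(T²; ℤ) ≅ ℤ^(2 choose k)`, homotopy invariance). [folklore] -/
theorem finrank_singularHomologyZ_U (k : ℕ) :
    Module.finrank ℤ (Literature.Topology.FourManifolds.singularHomologyZ U k) = Nat.choose 2 k := by
  obtain ⟨f⟩ := nonempty_singularHomology_torus_equiv ℤ ℤ 2 k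
  have e : Literature.Topology.FourManifolds.singularHomologyZ U k ≃ₗ[ℤ] (Fin (Nat.choose 2 k) → ℤ) :=
    (singularHomology.isoOfHomotopyEquiv ℤ ℤ homotopyEquivTorus k).toLinearEquiv ≪≫ₗ f
  rw [e.finrank_eq]
  simp

/-- **A non-compact door exists**: an `ℝ⁴`-charted `C^∞`, Hausdorff, second-countable, connected
4-manifold (the open set `U = (ℝ² ∖ 0)² ⊂ ℝ⁴`) with a smooth closed non-degenerate `MForm` and
`(b₁, b₂) = (2, 1)`. [folklore] -/
theorem exists_noncompact_door :
    ∃ (N : Type) (_ : TopologicalSpace N) (_ : T2Space N) (_ : SecondCountableTopology N)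
      (_ : ConnectedSpace N) (_ : ChartedSpace (EuclideanSpace ℝ (Fin 4)) N)
      (_ : IsManifold (𝓡 4) ∞ N) (s : MForm (𝓡 4) N ℝ 2),
      IsSmoothForm s ∧ IsClosedForm s ∧
      (∀ x (v : TangentSpace (𝓡 4) x), v ≠ 0 → ∃ w, s x ![v, w] ≠ 0) ∧
      Module.finrank ℤ (Literature.Topology.FourManifolds.singularHomologyZ N 1) = 2 ∧
      Module.finrank ℤ (Literature.Topology.FourManifolds.singularHomologyZ N 2) = 1 ∧
      ¬ CompactSpace N := by
  haveI := pathConnectedSpace_U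
  exact ⟨U, inferInstance, inferInstance, inferInstance, inferInstance, inferInstance, inferInstance,
    sU, isSmoothForm_sU, isClosedForm_sU, sU_nondegenerate, finrank_singularHomologyZ_U 1,
    finrank_singularHomologyZ_U 2, not_compactSpace_U⟩

/-- **Compactness is load-bearing for `NoGenusTwoDoor`**: the crux with the binder
`[CompactSpace N]` deleted (verbatim otherwise) is FALSE, refuted by `T*T² ≅ (ℝ² ∖ 0)² ⊂ ℝ⁴`
with `dx₀ ∧ dx₁ + dx₂ ∧ dx₃`. Any proof of the crux must use that `N` is closed. [folklore] -/
theorem noGenusTwoDoor_false_without_compact :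
    ¬ ∀ (N : Type) [TopologicalSpace N] [T2Space N] [SecondCountableTopology N]
        [ConnectedSpace N] [ChartedSpace (EuclideanSpace ℝ (Fin 4)) N] [IsManifold (𝓡 4) ∞ N]
        (s : MForm (𝓡 4) N ℝ 2), IsSmoothForm s → IsClosedForm s →
        (∀ x (v : TangentSpace (𝓡 4) x), v ≠ 0 → ∃ w, s x ![v, w] ≠ 0) →
        ¬ (Module.finrank ℤ (Literature.Topology.FourManifolds.singularHomologyZ N 1) = 2 ∧
            Module.finrank ℤ (Literature.Topology.FourManifolds.singularHomologyZ N 2) = 1) := by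
  intro h
  haveI := pathConnectedSpace_U
  exact h U sU isSmoothForm_sU isClosedForm_sU sU_nondegenerate
    ⟨finrank_singularHomologyZ_U 1, finrank_singularHomologyZ_U 2⟩

end Summit.SmoothPoincare4.SmoothPoincare4.Theorems.NoGenusTwoDoor.Negative

end
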